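import Summits.ABC.IUTFork.Joshi.TestVolumeCharacterDichotomy
import Literature.IUT.LogVolume.LogVolume
import HarnessLib

/-!
# Branch E TEST vs S — the (Ind1)/(Ind2) dichotomy is EXHAUSTIVE at every REAL-MEASURE instantiation:
# WHATEVER bicontinuous additive automorphisms the indeterminacies consist of, `S ∧ Statement` fails as typed

Proof-only Test file of the abc-iut cell, block E «type Joshi's construction, test vs S» (rung LADDER-ABC:A2.E; seat abc-iut-E-t44,
T-44 test/discharge seat; E-LOCATION.md §L1 TRICHOTOMY). TAKES NO SIDE on [IUTchIII] Cor. 3.12, on Joshi's claims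
(arXiv:2401.13508v4, unrefereed preprint, bib `Joshi2024ATS3`) or on Mochizuki's report on them; typed ≠ proved ≠ endorsed; a theorem
about OUR typed hull functional and OUR typed volume vocabulary, nothing more. 0 new definitions; imports abc-iut-E-t43's carrier-free
volume-character dichotomy (`Joshi/TestVolumeCharacterDichotomy.lean`, p431585: `volumeCharacter_dichotomy`,
`not_indCoversQ_or_not_statement`) and the campaign's classical Haar vocabulary (`Literature.IUT.LogVolume.IntegralStructure`:
`haar_image` — the MODULUS of a continuous additive automorphism, [AbsTopIII] Prop. 5.7 (i)(b); `normalizedLogVolume_image`) BY NAME.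

## The question this file closes (E-LOCATION §L1, «is the trichotomy exhaustive?»)

The located trichotomy of record: (i) an (Ind2) by isometries / lattice automorphisms cannot carry the Θ-pilot regions onto the q-pilot
region (X-06 `Joshi.not_indCoversQ_of_logvolInvariant`, p428758; at the real Dupuy–Hilado instantiation X-06-REAL p430041); (ii) an
(Ind2) containing Joshi's valuation-rescaling «ℚ_p-linear isomorphisms σ» ([J-III] §8.11.1 p.91 l.44–46) reaches S but makes the typed hull
`^{n,∘}𝒰` undefined, so the printed Statement fails AS TYPED (X-07′, abc-iut-E-t41; generic (+)-horn abc-iut-E-cx p430799 / abc-iut-E-t43).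
abc-iut-E-t43's `volumeCharacter_dichotomy` makes (i)∨(ii) a theorem for indeterminacies that act WITH A VOLUME CHARACTER
(`logvol(Φ·A) = logvol(A) + c_Φ`). A reader may still ask: could a cleverly chosen (Ind2) — neither isometric nor a uniform rescaling,
perhaps without any volume character — give BOTH S and the Statement? THIS FILE: **no, at every instantiation whose log-volumes are
REAL normalised Haar log-volumes** (the cell's own reading of Thm. 3.11 (i)(a), `Thm311LogvolInvariance.lean`: `logvol = μ^log_Λ ∘ e`,
admissible = positive finite Haar volume of the image) — because there EVERY bicontinuous additive automorphism `ψ` of a container HAS a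
volume character, its MODULUS `μ^log_Λ(ψ(Λ))` ([AbsTopIII] Prop. 5.7 (i)(b): `μ_Λ(ψ(A)) = μ_Λ(ψ(Λ))·μ_Λ(A)`, Haar uniqueness —
`IntegralStructure.haar_image`, in the tree). So the hypothesis «acts with a volume character» of abc-iut-E-t43's dichotomy is
DISCHARGED for ARBITRARY realisations of (Ind1)/(Ind2) by additive homeomorphisms of the containers — lattice-preserving or not,
`ℚ_p`-linear rescalings, shears, anything. (Related, landed: abc-iut-E-t43's `Literature.IUT.LogVolume.TensorPacketMeasureModulus`
p432469 = the modulus for `ℚ_p`-LINEAR automorphisms of the Dupuy–Hilado tensor packets; abc-iut-E-cx's `TestHullOrVolumeCharacter`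
p432121 = «S ⟹ ¬Statement at honest exponents» GIVEN characters. New here: the character hypothesis itself is discharged in the cell's
GENERIC real-measure reading — abstract containers `W`, integral structures `Λ`, reading maps `e`, as in `Thm311LogvolInvariance.lean` —
for every bicontinuous additive automorphism, `LogvolMono` is discharged too, and the two horns are packaged as `¬(S ∧ Statement)`.)

* `volumeCharacter_of_realMeasure` — each such generator transports admissibility both ways and shifts every admissible log-volume at
  `(j, v_ℚ)` by the constant `μ^log(ψ(Λ))/d` (its modulus);
* `logvolMono_of_realMeasure` — monotonicity of the typed log-volume (`LogvolMono`, a HYPOTHESIS of the harness files) HOLDS at every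
  real-measure instantiation (one hypothesis fewer downstream);
* **`realMeasure_dichotomy`** — at a real-measure instantiation with admissible Θ-regions: EITHER every (Ind1)/(Ind2) generator is
  volume-PRESERVING at every label of `𝔽_l^⋇` (horn (i): then X-06 applies) OR the printed Statement and the bridge hypotheses FAIL as
  typed (horn (ii)) — for EVERY choice of the realising homeomorphisms;
* **`not_pilotKummerIndRelated_and_statement_of_realMeasure`** — hence, at a real-measure instantiation with HONEST pilot volumes at one
  packet of a label in `𝔽_l^⋇` (q-datum region admissible and of strictly larger log-volume than every column-`m` Θ-datum region — the
  object-honest exponents `1 < j²`), Thm. 3.11 (ii)(b) for column `n` and the equivariance (hρ) of the region operator: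
  **`¬ (S ∧ P.Statement)`** — whatever (Ind1)/(Ind2) are. The two horns are separately inhabited (X-06-REAL p430041; X-07′).

LOCATED SENTENCE (no side taken): «In OUR typed framework — Θ-hull := hull of the full ⟨(Ind1) ∪ (Ind2)⟩-orbit, log-volumes = real
normalised Haar log-volumes — no enlargement whatsoever of (Ind1)/(Ind2) by bicontinuous additive automorphisms of the log-shell
containers yields S together with the printed inequality at honest pilot volumes: volume-preserving indeterminacies cannot move the
Θ-regions onto the q-region, all others destroy the hull.» Which (Ind2) [IUTchIII] intends, and whether a hull over the whole orbit is
intended, remain the attach points of E-LOCATION §L1 (EL-040 ↔ EL-079; Mochizuki2024JoshiReport (ShtAns)) — recorded, not decided.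
[claim: Joshi2024ATS3, status: disputed] [claim: Mochizuki2012, status: disputed] [cite: MochizukiAbsTopIII2015, Prop. 5.7 (i)(b) p. 138]
-/

noncomputable section

open Set MeasureTheory
open scoped ENNReal

namespace Summit.ABC.IUTFork.Joshi

open Thm311 Cor312 Cor312Vol Literature.IUT.LogVolume

variable {T : ThetaIndex} {S : LatticeSituation T} (P : Cor312.Setting S.toSituation)
  (ρ : (∀ v : T.V, v ∈ T.Vbad → Set (S.L.StarPacket v)) → ∀ (j : T.Label) (vQ : T.VQ), Set (S.L.Packet j vQ))
  (qK : ∀ v : T.V, v ∈ T.Vbad → Set (S.L.StarPacket v))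
  {W : T.Label → T.VQ → Type*} [∀ j vQ, AddCommGroup (W j vQ)]
  [∀ j vQ, TopologicalSpace (W j vQ)] [∀ j vQ, IsTopologicalAddGroup (W j vQ)]
  [∀ j vQ, MeasurableSpace (W j vQ)] [∀ j vQ, BorelSpace (W j vQ)]
  (Λ : ∀ j vQ, IntegralStructure (W j vQ)) (d : T.Label → T.VQ → ℕ)
  (e : ∀ (j : T.Label) (vQ : T.VQ), S.L.Packet j vQ → W j vQ)

/-! ## 1. Every additive homeomorphism of a container has a volume character (its modulus) -/

omit [∀ j vQ, IsTopologicalAddGroup (W j vQ)] [∀ j vQ, MeasurableSpace (W j vQ)] [∀ j vQ, BorelSpace (W j vQ)] in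
/-- Transport of an image along an intertwining relation: `e ∘ Φ = ψ ∘ e` pointwise gives `e(Φ(A)) = ψ(e(A))`. [folklore] -/
theorem image_image_of_intertwines {j : T.Label} {vQ : T.VQ} {Φ : S.L.Packet j vQ → S.L.Packet j vQ}
    {ψ : W j vQ ≃ₜ+ W j vQ} (h : ∀ x, e j vQ (Φ x) = ψ (e j vQ x)) (A : Set (S.L.Packet j vQ)) :
    e j vQ '' (Φ '' A) = ψ '' (e j vQ '' A) := by
  rw [image_image, image_image]
  exact image_congr fun x _ => h x

/-- **The modulus as a volume character.** At a REAL-MEASURE reading of the packet `(j, v_ℚ)` — `logvol = μ^log_Λ(e(−))/d`,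
admissible = `0 < μ_Λ(e(−)) < ∞` — a packet map `Φ` realised on the container by ANY bicontinuous additive automorphism `ψ` transports
admissibility both ways and shifts every admissible log-volume by the constant `μ^log_Λ(ψ(Λ))/d` ([AbsTopIII] Prop. 5.7 (i)(b),
`IntegralStructure.haar_image` / `normalizedLogVolume_image`). No lattice or isometry condition on `ψ`.
[cite: MochizukiAbsTopIII2015, Prop. 5.7 (i)(b) p. 138] -/
theorem volumeCharacter_of_realMeasure {j : T.Label} {vQ : T.VQ}
    (hlogvol : ∀ A : Set (S.L.Packet j vQ), (S.D P.n).logvol j vQ A = (Λ j vQ).normalizedLogVolume (d j vQ) (e j vQ '' A))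
    (hAdm : ∀ A : Set (S.L.Packet j vQ),
      (S.D P.n).Adm j vQ A ↔ 0 < (Λ j vQ).haar (e j vQ '' A) ∧ (Λ j vQ).haar (e j vQ '' A) < ∞)
    {Φ : S.L.PacketAut} {ψ : W j vQ ≃ₜ+ W j vQ} (hψ : ∀ x, e j vQ (Φ j vQ x) = ψ (e j vQ x)) :
    (∀ A : Set (S.L.Packet j vQ), (S.D P.n).Adm j vQ A ↔ (S.D P.n).Adm j vQ (Φ j vQ '' A)) ∧
      ∀ A : Set (S.L.Packet j vQ), (S.D P.n).Adm j vQ A →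
        (S.D P.n).logvol j vQ (Φ j vQ '' A) =
          (S.D P.n).logvol j vQ A + (Λ j vQ).normalizedLogVolume (d j vQ) (ψ '' (Λ j vQ : Set (W j vQ))) := by
  have hmod0 : (Λ j vQ).haar (ψ '' (Λ j vQ : Set (W j vQ))) ≠ 0 := ((Λ j vQ).haar_image_self_pos ψ).ne'
  have hmodT : (Λ j vQ).haar (ψ '' (Λ j vQ : Set (W j vQ))) ≠ ∞ := ((Λ j vQ).haar_image_self_lt_top ψ).ne
  refine ⟨fun A => ?_, fun A hA => ?_⟩
  · rw [hAdm, hAdm, image_image_of_intertwines e hψ, (Λ j vQ).haar_image ψ]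
    constructor
    · rintro ⟨h0, hT⟩
      exact ⟨ENNReal.mul_pos hmod0 h0.ne', ENNReal.mul_lt_top hmodT.lt_top hT⟩
    · rintro ⟨h0, hT⟩
      refine ⟨pos_iff_ne_zero.2 fun h => ?_, ?_⟩
      · rw [h, mul_zero] at h0
        exact lt_irrefl _ h0
      · rcases ENNReal.mul_lt_top_iff.1 hT with ⟨_, hx⟩ | h | h
        · exact hx
        · exact absurd h hmod0
        · rw [h]; exact ENNReal.zero_lt_top
  · obtain ⟨h0, hT⟩ := (hAdm A).1 hA
    rw [hlogvol, hlogvol, image_image_of_intertwines e hψ, (Λ j vQ).normalizedLogVolume_image (d j vQ) ψ h0 hT]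

/-- **`LogvolMono` HOLDS at every real-measure instantiation** (monotonicity of `μ^log_Λ` on sets of positive finite volume,
`IntegralStructure.normalizedLogVolume_mono`): one harness hypothesis fewer. [folklore] -/
theorem logvolMono_of_realMeasure
    (hlogvol : ∀ (j : T.Label) (vQ : T.VQ) (A : Set (S.L.Packet j vQ)),
      (S.D P.n).logvol j vQ A = (Λ j vQ).normalizedLogVolume (d j vQ) (e j vQ '' A))
    (hAdm : ∀ (j : T.Label) (vQ : T.VQ) (A : Set (S.L.Packet j vQ)),
      (S.D P.n).Adm j vQ A ↔ 0 < (Λ j vQ).haar (e j vQ '' A) ∧ (Λ j vQ).haar (e j vQ '' A) < ∞) :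
    LogvolMono P := by
  intro i vQ A B hA hB hAB
  rw [hlogvol, hlogvol]
  exact (Λ _ vQ).normalizedLogVolume_mono (d _ vQ) ((hAdm _ vQ A).1 hA).1 ((hAdm _ vQ B).1 hB).2 (image_mono hAB)

/-! ## 2. The dichotomy for ARBITRARY realisations of (Ind1)/(Ind2) -/

/-- **REAL-MEASURE DICHOTOMY — exhaustive over all (Ind1)/(Ind2).** At an instantiation whose line-`n` log-volumes are real normalised
Haar log-volumes read through maps `e` into locally compact containers, where EVERY (Ind1)-family and (Ind2)-family — whatever the
frozen `stripAut v` / `ism v` were instantiated to — acts on each container through SOME bicontinuous additive automorphism, and the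
Θ-regions are admissible: EITHER every generator preserves every admissible log-volume at every label of `𝔽_l^⋇` (horn (i): X-06
then forbids S at honest volumes), OR the printed Statement and the bridge hypotheses FAIL AS TYPED (horn (ii): the hull blow-up).
abc-iut-E-t43's `volumeCharacter_dichotomy` with its character hypothesis discharged by the modulus. [folklore] -/
theorem realMeasure_dichotomy
    (hlogvol : ∀ (j : T.Label) (vQ : T.VQ) (A : Set (S.L.Packet j vQ)),
      (S.D P.n).logvol j vQ A = (Λ j vQ).normalizedLogVolume (d j vQ) (e j vQ '' A))
    (hAdm : ∀ (j : T.Label) (vQ : T.VQ) (A : Set (S.L.Packet j vQ)),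
      (S.D P.n).Adm j vQ A ↔ 0 < (Λ j vQ).haar (e j vQ '' A) ∧ (Λ j vQ).haar (e j vQ '' A) < ∞)
    (hInd : ∀ Φ ∈ S.L.Ind1Family ∪ S.L.Ind2Family, ∀ (j : T.Label) (vQ : T.VQ),
      ∃ ψ : W j vQ ≃ₜ+ W j vQ, ∀ x, e j vQ (Φ j vQ x) = ψ (e j vQ x))
    (hΘadm : ThetaRegionsAdm P) :
    (∀ Φ ∈ S.L.Ind1Family ∪ S.L.Ind2Family, ∀ (i : Fin T.lstar) (vQ : T.VQ) (A : Set (S.L.Packet (Setting.labelSucc i) vQ)),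
        (S.D P.n).Adm _ vQ A → (S.D P.n).logvol _ vQ (Φ _ vQ '' A) = (S.D P.n).logvol _ vQ A) ∨
      (¬ P.Statement ∧ ¬ BridgeHyps P) := by
  classical
  -- the character: the modulus of the chosen realising homeomorphism (junk `0` off the generators)
  let c : S.L.PacketAut → ∀ (j : T.Label), T.VQ → ℝ := fun Φ j vQ =>
    if h : Φ ∈ S.L.Ind1Family ∪ S.L.Ind2Family then
      (Λ j vQ).normalizedLogVolume (d j vQ)
        (((Classical.choose (hInd Φ h j vQ) : W j vQ ≃ₜ+ W j vQ) : W j vQ → W j vQ) '' (Λ j vQ : Set (W j vQ)))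
    else 0
  have hc : ∀ Φ (h : Φ ∈ S.L.Ind1Family ∪ S.L.Ind2Family) (j : T.Label) (vQ : T.VQ),
      c Φ j vQ = (Λ j vQ).normalizedLogVolume (d j vQ)
        (((Classical.choose (hInd Φ h j vQ) : W j vQ ≃ₜ+ W j vQ) : W j vQ → W j vQ) '' (Λ j vQ : Set (W j vQ))) :=
    fun Φ h j vQ => dif_pos h
  have hchar := fun Φ (h : Φ ∈ S.L.Ind1Family ∪ S.L.Ind2Family) (j : T.Label) (vQ : T.VQ) =>
    volumeCharacter_of_realMeasure P Λ d e (hlogvol j vQ) (hAdm j vQ) (Classical.choose_spec (hInd Φ h j vQ))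
  rcases volumeCharacter_dichotomy P c (fun Φ h j vQ A => (hchar Φ h j vQ).1 A)
      (fun Φ h j vQ A hA => by rw [hc Φ h]; exact (hchar Φ h j vQ).2 A hA)
      (logvolMono_of_realMeasure P Λ d e hlogvol hAdm) hΘadm with h0 | hbad
  · refine Or.inl fun Φ h i vQ A hA => ?_
    rw [(hchar Φ h _ vQ).2 A hA, ← hc Φ h, h0 Φ h i vQ, add_zero]
  · exact Or.inr hbad

/-! ## 3. Hence `S ∧ Statement` fails at honest pilot volumes — for every (Ind1)/(Ind2) -/

/-- **At a real-measure instantiation with honest pilot volumes at ONE packet, `¬ (S ∧ Statement)` — whatever (Ind1)/(Ind2) are.**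
Hypotheses at the packet `(j = i+1, v_ℚ)` only (besides the real-measure reading and the realisation of the generators by additive
homeomorphisms): the q-datum region `ρ qK` and every column-`m` Θ-datum region `ρ (frobΨ m)` are admissible, the latter of STRICTLY
SMALLER log-volume (the object-honest exponents `j² > 1`), some Θ-region of the setting is admissible there; Thm. 3.11 (ii)(b) for
column `n` (`KummerB`) and the equivariance (hρ) of the region operator turn S into the containment `IndCoversQ` (abc-iut-E-cx
`indCoversQ_of_pilotKummerIndRelated`). Then abc-iut-E-t43's packet-local `not_indCoversQ_or_not_statement`, with the volume characters
supplied by the modulus, leaves `¬S ∨ ¬Statement`. [folklore] -/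
theorem not_pilotKummerIndRelated_and_statement_of_realMeasure {i : Fin T.lstar} {vQ : T.VQ}
    (hlogvol : ∀ A : Set (S.L.Packet (Setting.labelSucc i) vQ),
      (S.D P.n).logvol (Setting.labelSucc i) vQ A =
        (Λ (Setting.labelSucc i) vQ).normalizedLogVolume (d (Setting.labelSucc i) vQ) (e (Setting.labelSucc i) vQ '' A))
    (hAdm : ∀ A : Set (S.L.Packet (Setting.labelSucc i) vQ),
      (S.D P.n).Adm (Setting.labelSucc i) vQ A ↔
        0 < (Λ (Setting.labelSucc i) vQ).haar (e (Setting.labelSucc i) vQ '' A) ∧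
          (Λ (Setting.labelSucc i) vQ).haar (e (Setting.labelSucc i) vQ '' A) < ∞)
    (hInd : ∀ Φ ∈ S.L.Ind1Family ∪ S.L.Ind2Family,
      ∃ ψ : W (Setting.labelSucc i) vQ ≃ₜ+ W (Setting.labelSucc i) vQ,
        ∀ x, e (Setting.labelSucc i) vQ (Φ (Setting.labelSucc i) vQ x) = ψ (e (Setting.labelSucc i) vQ x))
    (hmono : LogvolMono P) (m₀ : ℤ) (hΘm : (S.D P.n).Adm (Setting.labelSucc i) vQ (P.thetaRegion m₀ (Setting.labelSucc i) vQ))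
    (hq : (S.D P.n).Adm (Setting.labelSucc i) vQ (ρ qK (Setting.labelSucc i) vQ))
    (hΘ : ∀ m : ℤ, (S.D P.n).Adm (Setting.labelSucc i) vQ (ρ ((S.col P.n).frobΨ m) (Setting.labelSucc i) vQ))
    (hlt : ∀ m : ℤ, (S.D P.n).logvol (Setting.labelSucc i) vQ (ρ ((S.col P.n).frobΨ m) (Setting.labelSucc i) vQ) <
      (S.D P.n).logvol (Setting.labelSucc i) vQ (ρ qK (Setting.labelSucc i) vQ))
    (hKumB : (S.col P.n).KummerB (S.D P.n))
    (hρ : ∀ Φ ∈ Subgroup.closure (S.L.Ind1Family ∪ S.L.Ind2Family),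
      ∀ (Ψ : ∀ v : T.V, v ∈ T.Vbad → Set (S.L.StarPacket v)) (j : T.Label) (vQ : T.VQ),
        ρ (fun v hv => S.L.starAut Φ v '' Ψ v hv) j vQ = Φ j vQ '' ρ Ψ j vQ) :
    ¬ (PilotKummerIndRelated S P ρ qK ∧ P.Statement) := by
  classical
  rintro ⟨hS, hSt⟩
  let c : S.L.PacketAut → ℝ := fun Φ =>
    if h : Φ ∈ S.L.Ind1Family ∪ S.L.Ind2Family then
      (Λ (Setting.labelSucc i) vQ).normalizedLogVolume (d (Setting.labelSucc i) vQ)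
        (((Classical.choose (hInd Φ h) : W (Setting.labelSucc i) vQ ≃ₜ+ W (Setting.labelSucc i) vQ) :
            W (Setting.labelSucc i) vQ → W (Setting.labelSucc i) vQ) ''
          (Λ (Setting.labelSucc i) vQ : Set (W (Setting.labelSucc i) vQ)))
    else 0
  have hc : ∀ Φ (h : Φ ∈ S.L.Ind1Family ∪ S.L.Ind2Family),
      c Φ = (Λ (Setting.labelSucc i) vQ).normalizedLogVolume (d (Setting.labelSucc i) vQ)
        (((Classical.choose (hInd Φ h) : W (Setting.labelSucc i) vQ ≃ₜ+ W (Setting.labelSucc i) vQ) :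
            W (Setting.labelSucc i) vQ → W (Setting.labelSucc i) vQ) ''
          (Λ (Setting.labelSucc i) vQ : Set (W (Setting.labelSucc i) vQ))) := fun Φ h => dif_pos h
  have hchar := fun Φ (h : Φ ∈ S.L.Ind1Family ∪ S.L.Ind2Family) =>
    volumeCharacter_of_realMeasure P Λ d e hlogvol hAdm (Classical.choose_spec (hInd Φ h))
  rcases not_indCoversQ_or_not_statement P ρ qK c (fun Φ h A => (hchar Φ h).1 A)
      (fun Φ h A hA => by rw [hc Φ h]; exact (hchar Φ h).2 A hA) hmono m₀ hΘm hq hΘ hlt with hnc | hbad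
  · exact hnc (indCoversQ_of_pilotKummerIndRelated hKumB hρ hS)
  · exact hbad.1 hSt

end Summit.ABC.IUTFork.Joshi

end
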